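import Mathlib
import Summits.KontsevichZagierPeriods.KontsevichZagierPeriods.Theorems.SoloInformedHoffman
import HarnessLib
import HarnessLib.Audit

/-!
# SoloInformed — PROGRAMME LI (relations file 4/4): Hoffman's relation at weight 7

Solo programme `solo-KontsevichZagierPeriods-informed`, session s48 (PROGRAMME LI).

Hoffman's relation (THEOREM L, `SoloInformedHoffman`: all depths, proved in `𝒫` by the SCALE
BAND STEP and the garland dissection) at the sixteen admissible `u` of weight `6`; both index
lists of the computable form `soloInformed_mzvClass_hoffman_list` evaluate by `rfl`.  These are
the relations that the finite double shuffle and duality do NOT supply at weight `7`: those leave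
corank `4` among the `32` classes, and with Hoffman's relation the corank is `3 = d₇` (exact
linear algebra over `ℤ`, this programme).

References: Hoffman 1992 Thm 5.1, 1997 Thm 4.2; Zagier 1994 §9; Kontsevich–Zagier 2001 §1.2;
Kaneko–Noro–Tsurumaki 2008 (tables of MZV relations by weight).
-/

noncomputable section

open Literature.NumberTheory.Transcendental
open Literature.NumberTheory.Transcendental.KZ

namespace Summit.KontsevichZagierPeriods.KontsevichZagierPeriods.Theorems

/-- Hoffman's relation for `u = [2, 1, 1, 1, 1]` in `𝒫` (THEOREM L, computable form, both index lists by `rfl`). -/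
theorem soloInformed_w7hof_21111 :
    mzvClass [3, 1, 1, 1, 1] + mzvClass [2, 2, 1, 1, 1] + mzvClass [2, 1, 2, 1, 1] +
      mzvClass [2, 1, 1, 2, 1] + mzvClass [2, 1, 1, 1, 2] =
      mzvClass [2, 1, 1, 1, 1, 1] := by
  have hl : soloInformedHofLHS [2, 1, 1, 1, 1] =
      [[3, 1, 1, 1, 1], [2, 2, 1, 1, 1], [2, 1, 2, 1, 1], [2, 1, 1, 2, 1], [2, 1, 1, 1, 2]] := rfl
  have hr : soloInformedHofRHS [2, 1, 1, 1, 1] =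
      [[2, 1, 1, 1, 1, 1]] := rfl
  have h := soloInformed_mzvClass_hoffman_list (u := [2, 1, 1, 1, 1]) (by decide) (by simp)
  rw [hl, hr] at h
  simp only [List.map_cons, List.map_nil, List.sum_cons, List.sum_nil, add_zero] at h
  linear_combination h

/-- Hoffman's relation for `u = [2, 1, 1, 2]` in `𝒫` (THEOREM L, computable form, both index lists by `rfl`). -/
theorem soloInformed_w7hof_2112 :
    mzvClass [3, 1, 1, 2] + mzvClass [2, 2, 1, 2] + mzvClass [2, 1, 2, 2] + mzvClass [2, 1, 1, 3] =
      mzvClass [2, 1, 1, 2, 1] + mzvClass [2, 1, 1, 1, 2] := by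
  have hl : soloInformedHofLHS [2, 1, 1, 2] =
      [[3, 1, 1, 2], [2, 2, 1, 2], [2, 1, 2, 2], [2, 1, 1, 3]] := rfl
  have hr : soloInformedHofRHS [2, 1, 1, 2] =
      [[2, 1, 1, 1, 2], [2, 1, 1, 2, 1]] := rfl
  have h := soloInformed_mzvClass_hoffman_list (u := [2, 1, 1, 2]) (by decide) (by simp)
  rw [hl, hr] at h
  simp only [List.map_cons, List.map_nil, List.sum_cons, List.sum_nil, add_zero] at h
  linear_combination h

/-- Hoffman's relation for `u = [2, 1, 2, 1]` in `𝒫` (THEOREM L, computable form, both index lists by `rfl`). -/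
theorem soloInformed_w7hof_2121 :
    mzvClass [3, 1, 2, 1] + mzvClass [2, 2, 2, 1] + mzvClass [2, 1, 3, 1] + mzvClass [2, 1, 2, 2] =
      mzvClass [2, 1, 2, 1, 1] + mzvClass [2, 1, 1, 2, 1] := by
  have hl : soloInformedHofLHS [2, 1, 2, 1] =
      [[3, 1, 2, 1], [2, 2, 2, 1], [2, 1, 3, 1], [2, 1, 2, 2]] := rfl
  have hr : soloInformedHofRHS [2, 1, 2, 1] =
      [[2, 1, 1, 2, 1], [2, 1, 2, 1, 1]] := rfl
  have h := soloInformed_mzvClass_hoffman_list (u := [2, 1, 2, 1]) (by decide) (by simp)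
  rw [hl, hr] at h
  simp only [List.map_cons, List.map_nil, List.sum_cons, List.sum_nil, add_zero] at h
  linear_combination h

/-- Hoffman's relation for `u = [2, 1, 3]` in `𝒫` (THEOREM L, computable form, both index lists by `rfl`). -/
theorem soloInformed_w7hof_213 :
    mzvClass [3, 1, 3] + mzvClass [2, 2, 3] + mzvClass [2, 1, 4] =
      mzvClass [2, 1, 3, 1] + mzvClass [2, 1, 2, 2] + mzvClass [2, 1, 1, 3] := by
  have hl : soloInformedHofLHS [2, 1, 3] =
      [[3, 1, 3], [2, 2, 3], [2, 1, 4]] := rfl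
  have hr : soloInformedHofRHS [2, 1, 3] =
      [[2, 1, 1, 3], [2, 1, 2, 2], [2, 1, 3, 1]] := rfl
  have h := soloInformed_mzvClass_hoffman_list (u := [2, 1, 3]) (by decide) (by simp)
  rw [hl, hr] at h
  simp only [List.map_cons, List.map_nil, List.sum_cons, List.sum_nil, add_zero] at h
  linear_combination h

/-- Hoffman's relation for `u = [2, 2, 1, 1]` in `𝒫` (THEOREM L, computable form, both index lists by `rfl`). -/
theorem soloInformed_w7hof_2211 :
    mzvClass [3, 2, 1, 1] + mzvClass [2, 3, 1, 1] + mzvClass [2, 2, 2, 1] + mzvClass [2, 2, 1, 2] =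
      mzvClass [2, 2, 1, 1, 1] + mzvClass [2, 1, 2, 1, 1] := by
  have hl : soloInformedHofLHS [2, 2, 1, 1] =
      [[3, 2, 1, 1], [2, 3, 1, 1], [2, 2, 2, 1], [2, 2, 1, 2]] := rfl
  have hr : soloInformedHofRHS [2, 2, 1, 1] =
      [[2, 1, 2, 1, 1], [2, 2, 1, 1, 1]] := rfl
  have h := soloInformed_mzvClass_hoffman_list (u := [2, 2, 1, 1]) (by decide) (by simp)
  rw [hl, hr] at h
  simp only [List.map_cons, List.map_nil, List.sum_cons, List.sum_nil, add_zero] at h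
  linear_combination h

/-- Hoffman's relation for `u = [2, 2, 2]` in `𝒫` (THEOREM L, computable form, both index lists by `rfl`). -/
theorem soloInformed_w7hof_222 :
    mzvClass [3, 2, 2] + mzvClass [2, 3, 2] + mzvClass [2, 2, 3] =
      mzvClass [2, 2, 2, 1] + mzvClass [2, 2, 1, 2] + mzvClass [2, 1, 2, 2] := by
  have hl : soloInformedHofLHS [2, 2, 2] =
      [[3, 2, 2], [2, 3, 2], [2, 2, 3]] := rfl
  have hr : soloInformedHofRHS [2, 2, 2] =
      [[2, 1, 2, 2], [2, 2, 1, 2], [2, 2, 2, 1]] := rfl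
  have h := soloInformed_mzvClass_hoffman_list (u := [2, 2, 2]) (by decide) (by simp)
  rw [hl, hr] at h
  simp only [List.map_cons, List.map_nil, List.sum_cons, List.sum_nil, add_zero] at h
  linear_combination h

/-- Hoffman's relation for `u = [2, 3, 1]` in `𝒫` (THEOREM L, computable form, both index lists by `rfl`). -/
theorem soloInformed_w7hof_231 :
    mzvClass [3, 3, 1] + mzvClass [2, 4, 1] + mzvClass [2, 3, 2] =
      mzvClass [2, 3, 1, 1] + mzvClass [2, 2, 2, 1] + mzvClass [2, 1, 3, 1] := by
  have hl : soloInformedHofLHS [2, 3, 1] =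
      [[3, 3, 1], [2, 4, 1], [2, 3, 2]] := rfl
  have hr : soloInformedHofRHS [2, 3, 1] =
      [[2, 1, 3, 1], [2, 2, 2, 1], [2, 3, 1, 1]] := rfl
  have h := soloInformed_mzvClass_hoffman_list (u := [2, 3, 1]) (by decide) (by simp)
  rw [hl, hr] at h
  simp only [List.map_cons, List.map_nil, List.sum_cons, List.sum_nil, add_zero] at h
  linear_combination h

/-- Hoffman's relation for `u = [2, 4]` in `𝒫` (THEOREM L, computable form, both index lists by `rfl`). -/
theorem soloInformed_w7hof_24 :
    mzvClass [3, 4] + mzvClass [2, 5] =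
      mzvClass [2, 4, 1] + mzvClass [2, 3, 2] + mzvClass [2, 2, 3] + mzvClass [2, 1, 4] := by
  have hl : soloInformedHofLHS [2, 4] =
      [[3, 4], [2, 5]] := rfl
  have hr : soloInformedHofRHS [2, 4] =
      [[2, 1, 4], [2, 2, 3], [2, 3, 2], [2, 4, 1]] := rfl
  have h := soloInformed_mzvClass_hoffman_list (u := [2, 4]) (by decide) (by simp)
  rw [hl, hr] at h
  simp only [List.map_cons, List.map_nil, List.sum_cons, List.sum_nil, add_zero] at h
  linear_combination h

/-- Hoffman's relation for `u = [3, 1, 1, 1]` in `𝒫` (THEOREM L, computable form, both index lists by `rfl`). -/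
theorem soloInformed_w7hof_3111 :
    mzvClass [4, 1, 1, 1] + mzvClass [3, 2, 1, 1] + mzvClass [3, 1, 2, 1] + mzvClass [3, 1, 1, 2] =
      mzvClass [3, 1, 1, 1, 1] + mzvClass [2, 2, 1, 1, 1] := by
  have hl : soloInformedHofLHS [3, 1, 1, 1] =
      [[4, 1, 1, 1], [3, 2, 1, 1], [3, 1, 2, 1], [3, 1, 1, 2]] := rfl
  have hr : soloInformedHofRHS [3, 1, 1, 1] =
      [[2, 2, 1, 1, 1], [3, 1, 1, 1, 1]] := rfl
  have h := soloInformed_mzvClass_hoffman_list (u := [3, 1, 1, 1]) (by decide) (by simp)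
  rw [hl, hr] at h
  simp only [List.map_cons, List.map_nil, List.sum_cons, List.sum_nil, add_zero] at h
  linear_combination h

/-- Hoffman's relation for `u = [3, 1, 2]` in `𝒫` (THEOREM L, computable form, both index lists by `rfl`). -/
theorem soloInformed_w7hof_312 :
    mzvClass [4, 1, 2] + mzvClass [3, 2, 2] + mzvClass [3, 1, 3] =
      mzvClass [3, 1, 2, 1] + mzvClass [3, 1, 1, 2] + mzvClass [2, 2, 1, 2] := by
  have hl : soloInformedHofLHS [3, 1, 2] =
      [[4, 1, 2], [3, 2, 2], [3, 1, 3]] := rfl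
  have hr : soloInformedHofRHS [3, 1, 2] =
      [[2, 2, 1, 2], [3, 1, 1, 2], [3, 1, 2, 1]] := rfl
  have h := soloInformed_mzvClass_hoffman_list (u := [3, 1, 2]) (by decide) (by simp)
  rw [hl, hr] at h
  simp only [List.map_cons, List.map_nil, List.sum_cons, List.sum_nil, add_zero] at h
  linear_combination h

/-- Hoffman's relation for `u = [3, 2, 1]` in `𝒫` (THEOREM L, computable form, both index lists by `rfl`). -/
theorem soloInformed_w7hof_321 :
    mzvClass [4, 2, 1] + mzvClass [3, 3, 1] + mzvClass [3, 2, 2] =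
      mzvClass [3, 2, 1, 1] + mzvClass [3, 1, 2, 1] + mzvClass [2, 2, 2, 1] := by
  have hl : soloInformedHofLHS [3, 2, 1] =
      [[4, 2, 1], [3, 3, 1], [3, 2, 2]] := rfl
  have hr : soloInformedHofRHS [3, 2, 1] =
      [[2, 2, 2, 1], [3, 1, 2, 1], [3, 2, 1, 1]] := rfl
  have h := soloInformed_mzvClass_hoffman_list (u := [3, 2, 1]) (by decide) (by simp)
  rw [hl, hr] at h
  simp only [List.map_cons, List.map_nil, List.sum_cons, List.sum_nil, add_zero] at h
  linear_combination h

/-- Hoffman's relation for `u = [3, 3]` in `𝒫` (THEOREM L, computable form, both index lists by `rfl`). -/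
theorem soloInformed_w7hof_33 :
    mzvClass [4, 3] + mzvClass [3, 4] =
      mzvClass [3, 3, 1] + mzvClass [3, 2, 2] + mzvClass [3, 1, 3] + mzvClass [2, 2, 3] := by
  have hl : soloInformedHofLHS [3, 3] =
      [[4, 3], [3, 4]] := rfl
  have hr : soloInformedHofRHS [3, 3] =
      [[2, 2, 3], [3, 1, 3], [3, 2, 2], [3, 3, 1]] := rfl
  have h := soloInformed_mzvClass_hoffman_list (u := [3, 3]) (by decide) (by simp)
  rw [hl, hr] at h
  simp only [List.map_cons, List.map_nil, List.sum_cons, List.sum_nil, add_zero] at h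
  linear_combination h

/-- Hoffman's relation for `u = [4, 1, 1]` in `𝒫` (THEOREM L, computable form, both index lists by `rfl`). -/
theorem soloInformed_w7hof_411 :
    mzvClass [5, 1, 1] + mzvClass [4, 2, 1] + mzvClass [4, 1, 2] =
      mzvClass [4, 1, 1, 1] + mzvClass [3, 2, 1, 1] + mzvClass [2, 3, 1, 1] := by
  have hl : soloInformedHofLHS [4, 1, 1] =
      [[5, 1, 1], [4, 2, 1], [4, 1, 2]] := rfl
  have hr : soloInformedHofRHS [4, 1, 1] =
      [[2, 3, 1, 1], [3, 2, 1, 1], [4, 1, 1, 1]] := rfl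
  have h := soloInformed_mzvClass_hoffman_list (u := [4, 1, 1]) (by decide) (by simp)
  rw [hl, hr] at h
  simp only [List.map_cons, List.map_nil, List.sum_cons, List.sum_nil, add_zero] at h
  linear_combination h

/-- Hoffman's relation for `u = [4, 2]` in `𝒫` (THEOREM L, computable form, both index lists by `rfl`). -/
theorem soloInformed_w7hof_42 :
    mzvClass [5, 2] + mzvClass [4, 3] =
      mzvClass [4, 2, 1] + mzvClass [4, 1, 2] + mzvClass [3, 2, 2] + mzvClass [2, 3, 2] := by
  have hl : soloInformedHofLHS [4, 2] =
      [[5, 2], [4, 3]] := rfl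
  have hr : soloInformedHofRHS [4, 2] =
      [[2, 3, 2], [3, 2, 2], [4, 1, 2], [4, 2, 1]] := rfl
  have h := soloInformed_mzvClass_hoffman_list (u := [4, 2]) (by decide) (by simp)
  rw [hl, hr] at h
  simp only [List.map_cons, List.map_nil, List.sum_cons, List.sum_nil, add_zero] at h
  linear_combination h

/-- Hoffman's relation for `u = [5, 1]` in `𝒫` (THEOREM L, computable form, both index lists by `rfl`). -/
theorem soloInformed_w7hof_51 :
    mzvClass [6, 1] + mzvClass [5, 2] =
      mzvClass [5, 1, 1] + mzvClass [4, 2, 1] + mzvClass [3, 3, 1] + mzvClass [2, 4, 1] := by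
  have hl : soloInformedHofLHS [5, 1] =
      [[6, 1], [5, 2]] := rfl
  have hr : soloInformedHofRHS [5, 1] =
      [[2, 4, 1], [3, 3, 1], [4, 2, 1], [5, 1, 1]] := rfl
  have h := soloInformed_mzvClass_hoffman_list (u := [5, 1]) (by decide) (by simp)
  rw [hl, hr] at h
  simp only [List.map_cons, List.map_nil, List.sum_cons, List.sum_nil, add_zero] at h
  linear_combination h

/-- Hoffman's relation for `u = [6]` in `𝒫` (THEOREM L, computable form, both index lists by `rfl`). -/
theorem soloInformed_w7hof_6 :
    mzvClass [7] =
      mzvClass [6, 1] + mzvClass [5, 2] + mzvClass [4, 3] + mzvClass [3, 4] + mzvClass [2, 5] := by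
  have hl : soloInformedHofLHS [6] =
      [[7]] := rfl
  have hr : soloInformedHofRHS [6] =
      [[2, 5], [3, 4], [4, 3], [5, 2], [6, 1]] := rfl
  have h := soloInformed_mzvClass_hoffman_list (u := [6]) (by decide) (by simp)
  rw [hl, hr] at h
  simp only [List.map_cons, List.map_nil, List.sum_cons, List.sum_nil, add_zero] at h
  linear_combination h


end Summit.KontsevichZagierPeriods.KontsevichZagierPeriods.Theorems
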